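import Mathlib
import Literature.Combinatorics.Enumerative.InvolutionsAvoiding4321
import Literature.Combinatorics.Enumerative.InvolutionsAvoiding231
import HarnessLib

/-!
# Involutions avoiding `4321` and `312`: `|I_n(4321, 312)| = |I_n(4321, 231)| = t_{n+2}` (Tribonacci; Barnabei–Bonetti–Silimbani 2011, Theorem 5 (iii) / Corollary 6 (iii))

Layer `Literature/Combinatorics/Enumerative`, namespace `Literature.Combinatorics.Enumerative.PermContainsPattern`; lane
`lit-hodgefound` (prover seat p13, generation 39, theme «nonnesting / noncrossing matchings and restricted
involutions»).  Sequel of `InvolutionsAvoiding4321.lean` (THEOREM 2 on arcs: `4321` ⟺ two nested arcs) and of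
`InvolutionsAvoiding231.lean` (Simion–Schmidt Proposition 6: the involutions avoiding `312` are the permutations
avoiding `231` and `312`, the layered permutations — each opener `i` starts a reversed block `[i, v i]`:
`apply_mem_Ioo_of_av231_av312`, `apply_lt_apply_of_av231_av312`).

## Source

M. Barnabei, F. Bonetti, M. Silimbani, *Restricted involutions and Motzkin paths*, Adv. Appl. Math. **47** (2011)
102–115 = arXiv:0812.0463 [BarnabeiBonettiSilimbani2011] (held text `paper-arxiv-0812.0463`, arXiv numbering, §4):

> **Theorem 5.** Let `τ` be an involution in `I_n(4321)` … iii. `τ` avoids `312`, and hence `231`, if and only if the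
> irreducible components of `M` are either `H`, or `UHD`, or `UD`.
> **Corollary 6.** … iii. `I_n(4321,312) = I_n(4321,231)` and `|I_n(4321,312)| = t_{n+2}`, where `t_n` is the sequence
> of Tribonacci numbers defined by `t_0 = 0`, `t_1 = 0`, `t_2 = 1` and `t_{n+3} = t_{n+2} + t_{n+1} + t_n`.
> [proof] A Motzkin path associated with an involution in `I_n(4321,312)` has irreducible components of the kind `H`,
> `B_1 = UHD` and `P_1 = UD`. Hence, such a Motzkin path `M ∈ 𝓜_{n+3}` can be obtained by adding 1. an `H` step at the
> end of a path of the same kind in `𝓜_{n+2}`; 2. a subpath `P_1` at the end of a path of the same kind in `𝓜_{n+1}`;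
> 3. a subpath `B_1` at the end of a path of the same kind in `𝓜_n`. Moreover, `|I_1(4321,312)| = 1 = t_3`,
> `|I_2(4321,312)| = 2 = t_4` and `|I_3(4321,312)| = 4 = t_5`.
> «Formulas i. and iii., up to our knowledge, are new.»

## Formalisation (arc language; one definition `tribonacci`, theorems otherwise)

An involution avoiding `312` is layered (Simion–Schmidt): its last letter lies in a reversed final block
`[i, last]`, `i = u(last)`.  With `4321` forbidden the block has at most `3` letters (a reversed block of `4` or more
letters has the nested arcs `(i, last) ⊃ (i+1, u(i+1))`: `card_involutions_av4321_av312_lastFar`), so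
`u = τ ⊕ rev_{d+1}`, `d ∈ {0, 1, 2}` (`H`, `UD`, `UHD` at the end), `τ ∈ I_{n−d−1}(4321, 312)` (§2
`card_involutions_av4321_av312_lastBlock`).  Hence ★★ `card_involutions_av4321_av312_add_three`
(`a_{m+3} = a_{m+2} + a_{m+1} + a_m`) and ★★★ `card_involutions_av4321_av312 : |I_n(4321, 312)| = tribonacci (n + 2)`;
`card_involutions_av4321_av231` (the same set, Simion–Schmidt).
-/

namespace Literature.Combinatorics.Enumerative

open Finset

/-! ### §0 The Tribonacci numbers -/

/-- **The Tribonacci numbers** (OEIS A000073): `t_0 = 0`, `t_1 = 0`, `t_2 = 1`, `t_{n+3} = t_{n+2} + t_{n+1} + t_n`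
(`0, 0, 1, 1, 2, 4, 7, 13, 24, 44, …`). [cite: BarnabeiBonettiSilimbani2011, Corollary 6 (iii) (arXiv 0812.0463)] -/
def tribonacci : ℕ → ℕ
  | 0 => 0
  | 1 => 0
  | 2 => 1
  | n + 3 => tribonacci (n + 2) + tribonacci (n + 1) + tribonacci n

/-- `t_0 = 0`. [cite: BarnabeiBonettiSilimbani2011, Corollary 6 (iii) (arXiv 0812.0463)] -/
@[simp] theorem tribonacci_zero : tribonacci 0 = 0 := rfl

/-- `t_1 = 0`. [cite: BarnabeiBonettiSilimbani2011, Corollary 6 (iii) (arXiv 0812.0463)] -/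
@[simp] theorem tribonacci_one : tribonacci 1 = 0 := rfl

/-- `t_2 = 1`. [cite: BarnabeiBonettiSilimbani2011, Corollary 6 (iii) (arXiv 0812.0463)] -/
@[simp] theorem tribonacci_two : tribonacci 2 = 1 := rfl

/-- The recurrence `t_{n+3} = t_{n+2} + t_{n+1} + t_n`. [cite: BarnabeiBonettiSilimbani2011, Corollary 6 (iii) (arXiv 0812.0463)] -/
theorem tribonacci_add_three (n : ℕ) : tribonacci (n + 3) = tribonacci (n + 2) + tribonacci (n + 1) + tribonacci n := rfl

/-- `t_3, …, t_9 = 1, 2, 4, 7, 13, 24, 44`. [cite: BarnabeiBonettiSilimbani2011, Corollary 6 (iii) (arXiv 0812.0463)] -/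
theorem tribonacci_values : (List.range 10).map tribonacci = [0, 0, 1, 1, 2, 4, 7, 13, 24, 44] := by decide

namespace PermContainsPattern

open Equiv

variable {n m : ℕ}

/-! ### §1 The reversal blocks `H`, `UD`, `UHD` -/

/-- A reversal avoids `312` (it has no ascent). [cite: SimionSchmidt1985, Proposition 6 (held text p0009)] -/
theorem revPerm_not_contains_312 (k : ℕ) : ¬ PermContainsPattern (Fin.revPerm : Perm (Fin k)) ![3, 1, 2] := by
  intro h
  obtain ⟨i, j, l, -, hjl, h1, -⟩ := (contains_312_iff _).1 h
  rw [Fin.revPerm_apply, Fin.revPerm_apply, Fin.rev_lt_rev] at h1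
  exact lt_asymm hjl h1

/-- A reversal of at most three letters avoids `4321`. [cite: BarnabeiBonettiSilimbani2011, Theorem 5 (iii) (arXiv 0812.0463)] -/
theorem revPerm_not_contains_4321 {d : ℕ} (hd : d ≤ 2) :
    ¬ PermContainsPattern (Fin.revPerm : Perm (Fin (d + 1))) ![4, 3, 2, 1] :=
  not_contains_of_lt _ _ (by omega)

/-! ### §2 The fibres over the partner of the last letter -/

/-- ★★ **The last block.** For `d ≤ 2`, the involutions of `I_{m+d+1}(4321, 312)` whose last letter is exchanged with
the letter `m` (i.e. whose final reversed block has `d + 1` letters: `H`, `UD`, `UHD`) are the `τ ⊕ rev_{d+1}`,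
`τ ∈ I_m(4321, 312)`. [cite: BarnabeiBonettiSilimbani2011, Theorem 5 (iii) and Corollary 6 (iii) (arXiv 0812.0463)] -/
theorem card_involutions_av4321_av312_lastBlock (m d : ℕ) (hd : d ≤ 2) :
    Nat.card {u : Perm (Fin (m + (d + 1))) // (u * u = 1 ∧ ¬ PermContainsPattern u ![4, 3, 2, 1] ∧
        ¬ PermContainsPattern u ![3, 1, 2]) ∧ ((u (Fin.natAdd m (Fin.last d)) : ℕ)) = m} =
      Nat.card {τ : Perm (Fin m) // τ * τ = 1 ∧ ¬ PermContainsPattern τ ![4, 3, 2, 1] ∧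
        ¬ PermContainsPattern τ ![3, 1, 2]} := by
  have hrev : (Fin.revPerm : Perm (Fin (d + 1))) * Fin.revPerm = 1 := revPerm_mul_revPerm'
  have hq4 : (![4, 3, 2, 1] : Fin 4 → ℕ) (Fin.last 3) < (![4, 3, 2, 1] : Fin 4 → ℕ) 0 := by decide
  have hq3 : (![3, 1, 2] : Fin 3 → ℕ) (Fin.last 2) < (![3, 1, 2] : Fin 3 → ℕ) 0 := by decide
  refine (Nat.card_congr (Equiv.ofBijective (fun τ : {τ : Perm (Fin m) // τ * τ = 1 ∧
      ¬ PermContainsPattern τ ![4, 3, 2, 1] ∧ ¬ PermContainsPattern τ ![3, 1, 2]} =>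
    (⟨finSumFinEquiv.symm.trans ((τ.1.sumCongr (Fin.revPerm : Perm (Fin (d + 1)))).trans finSumFinEquiv),
      ⟨(directSum_mul_self_eq_one_iff τ.1 _).2 ⟨τ.2.1, hrev⟩,
        not_contains_directSum hq4 τ.2.2.1 (revPerm_not_contains_4321 hd),
        not_contains_directSum hq3 τ.2.2.2 (revPerm_not_contains_312 _)⟩,
      by rw [directSum_apply_natAdd, Fin.revPerm_apply, Fin.rev_last, Fin.val_natAdd, Fin.val_zero, add_zero]⟩ :
    {u : Perm (Fin (m + (d + 1))) // (u * u = 1 ∧ ¬ PermContainsPattern u ![4, 3, 2, 1] ∧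
      ¬ PermContainsPattern u ![3, 1, 2]) ∧ ((u (Fin.natAdd m (Fin.last d)) : ℕ)) = m})) ⟨?_, ?_⟩)).symm
  · rintro ⟨τ, hτ⟩ ⟨τ', hτ'⟩ h
    have h2 := Prod.ext_iff.mp (directSum_injective m (d + 1) (a₁ := (τ, Fin.revPerm)) (a₂ := (τ', Fin.revPerm))
      (congrArg Subtype.val h))
    exact Subtype.ext h2.1
  · rintro ⟨u, ⟨hinv, h4321, h312⟩, hlast⟩
    have hu : ∀ x, u (u x) = x := (mul_self_eq_one_iff_apply_apply u).1 hinv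
    have h231 : ¬ PermContainsPattern u ![2, 3, 1] := ((involution_and_av312_iff u).1 ⟨hinv, h312⟩).1
    -- the arc `(m, last)`
    have hl : u (Fin.natAdd m (Fin.last d)) = Fin.natAdd m 0 := Fin.ext (by rw [hlast]; simp)
    have hl' : u (Fin.natAdd m 0) = Fin.natAdd m (Fin.last d) := by rw [← hl, hu]
    -- the block `[m, last]` is mapped into itself, hence so is its complement
    have hblock : ∀ q : Fin (m + (d + 1)), m ≤ (q : ℕ) → m ≤ ((u q : Fin (m + (d + 1))) : ℕ) := by
      intro q hq
      rcases (show q = Fin.natAdd m 0 ∨ q = Fin.natAdd m (Fin.last d) ∨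
          (Fin.natAdd m 0 < q ∧ q < Fin.natAdd m (Fin.last d)) from by
        rcases lt_trichotomy q (Fin.natAdd m 0) with h | h | h
        · exact absurd (Fin.lt_def.1 h) (by simp; omega)
        · exact Or.inl h
        · rcases lt_trichotomy q (Fin.natAdd m (Fin.last d)) with h' | h' | h'
          · exact Or.inr (Or.inr ⟨h, h'⟩)
          · exact Or.inr (Or.inl h')
          · exact absurd (Fin.lt_def.1 h') (by have := q.2; simp [Fin.val_last]; omega)) with rfl | rfl | ⟨h1, h2⟩
      · rw [hl']; simp
      · rw [hl]; simp
      · have := (apply_mem_Ioo_of_av231_av312 h231 h312 h1 (by rw [hl']; exact h2)).1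
        have := Fin.lt_def.1 this
        simp at this
        omega
    have hlow : ∀ i : Fin m, ((u (Fin.castAdd (d + 1) i)) : ℕ) < m := by
      intro i
      by_contra hc
      push Not at hc
      have := hblock (u (Fin.castAdd (d + 1) i)) hc
      rw [hu, Fin.val_castAdd] at this
      exact absurd i.2 (not_lt.2 this)
    obtain ⟨τ, ρ, hσ⟩ := exists_eq_directSum u hlow
    -- `ρ` is a reversal: it avoids `231`, `312` and exchanges its ends, so it decreases on `[0, last]`
    have hρ231 : ¬ PermContainsPattern ρ ![2, 3, 1] := fun h => h231 (hσ ▸ trans (directSum_contains_right τ ρ) h)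
    have hρ312 : ¬ PermContainsPattern ρ ![3, 1, 2] := fun h => h312 (hσ ▸ trans (directSum_contains_right τ ρ) h)
    have hρ0 : ρ 0 = Fin.last d := by
      have := hl'
      rw [hσ, directSum_apply_natAdd] at this
      exact Fin.natAdd_injective _ _ this
    have hρ : ρ = Fin.revPerm := eq_revPerm_of_strictAnti fun p q hpq =>
      apply_lt_apply_of_av231_av312 hρ231 hρ312 (Fin.zero_le p) hpq (by rw [hρ0]; exact Fin.le_last q)
    subst hσ
    subst hρ
    exact ⟨⟨τ, ((directSum_mul_self_eq_one_iff τ _).1 hinv).1,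
      fun h => h4321 (trans (directSum_contains_left τ _) h),
      fun h => h312 (trans (directSum_contains_left τ _) h)⟩, rfl⟩

/-- A reversed final block of four or more letters contains two nested arcs: in `I_{n+1}(4321, 312)` the last letter is
exchanged with one of the last three letters. [cite: BarnabeiBonettiSilimbani2011, Theorem 5 (iii) (arXiv 0812.0463)] -/
theorem card_involutions_av4321_av312_lastFar (n : ℕ) (i : Fin (n + 1)) (hi : (i : ℕ) + 3 ≤ n) :
    Nat.card {u : Perm (Fin (n + 1)) // (u * u = 1 ∧ ¬ PermContainsPattern u ![4, 3, 2, 1] ∧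
        ¬ PermContainsPattern u ![3, 1, 2]) ∧ u (Fin.last n) = i} = 0 := by
  rw [Nat.card_eq_zero]
  left
  refine ⟨fun ⟨u, ⟨hinv, h4321, h312⟩, hlast⟩ => ?_⟩
  have hu : ∀ x, u (u x) = x := (mul_self_eq_one_iff_apply_apply u).1 hinv
  have h231 : ¬ PermContainsPattern u ![2, 3, 1] := ((involution_and_av312_iff u).1 ⟨hinv, h312⟩).1
  have hnn := (not_contains_4321_iff_nonnesting hu).1 h4321
  have hui : u i = Fin.last n := by rw [← hlast, hu]
  set q1 : Fin (n + 1) := ⟨(i : ℕ) + 1, by omega⟩ with hq1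
  set q2 : Fin (n + 1) := ⟨(i : ℕ) + 2, by omega⟩ with hq2
  have hiq1 : i < q1 := Fin.lt_def.2 (by simp [hq1])
  have hq12 : q1 < q2 := Fin.lt_def.2 (by simp [hq1, hq2])
  have hq1l : q1 < u i := by rw [hui]; exact Fin.lt_def.2 (by simp [hq1, Fin.val_last]; omega)
  have hq2l : q2 < u i := by rw [hui]; exact Fin.lt_def.2 (by simp [hq2, Fin.val_last]; omega)
  have h1 := apply_mem_Ioo_of_av231_av312 h231 h312 hiq1 hq1l
  have h2 := apply_mem_Ioo_of_av231_av312 h231 h312 (hiq1.trans hq12) hq2l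
  have h3 := apply_lt_apply_of_av231_av312 h231 h312 hiq1.le hq12 hq2l.le
  -- `u q1 > u q2 > i`, so `u q1 ≥ i + 2 > q1`: the arc from `q1` is nested in `(i, last)`
  refine hnn i q1 hiq1 (Fin.lt_def.2 ?_) h1.2
  have e1 := Fin.lt_def.1 h2.1
  have e2 := Fin.lt_def.1 h3
  change (i : ℕ) + 1 < _
  omega

/-! ### §3 The Tribonacci recurrence and COROLLARY 6 (iii) -/

/-- Splitting a finite subtype along a statistic with values in a `Fintype`. [folklore] -/
private theorem card_subtype_eq_sum_fiber₅ {α β : Type*} [Finite α] [Fintype β] (P : α → Prop) (f : α → β) :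
    Nat.card {x // P x} = ∑ t : β, Nat.card {x // P x ∧ f x = t} := by
  rw [← Nat.card_sigma]
  exact Nat.card_congr ((Equiv.sigmaFiberEquiv fun x : {x // P x} => f x.1).symm.trans
    (Equiv.sigmaCongrRight fun t => Equiv.subtypeSubtypeEquivSubtypeInter P fun x => f x = t))

/-- ★★ **The Tribonacci recurrence**: `|I_{m+3}(4321, 312)| = |I_{m+2}(4321, 312)| + |I_{m+1}(4321, 312)| +
|I_m(4321, 312)|` (the final block is `H`, `UD` or `UHD`). [cite: BarnabeiBonettiSilimbani2011, Corollary 6 (iii) (arXiv 0812.0463)] -/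
theorem card_involutions_av4321_av312_add_three (m : ℕ) :
    Nat.card {u : Perm (Fin (m + 3)) // u * u = 1 ∧ ¬ PermContainsPattern u ![4, 3, 2, 1] ∧
        ¬ PermContainsPattern u ![3, 1, 2]} =
      Nat.card {u : Perm (Fin (m + 2)) // u * u = 1 ∧ ¬ PermContainsPattern u ![4, 3, 2, 1] ∧
          ¬ PermContainsPattern u ![3, 1, 2]} +
        Nat.card {u : Perm (Fin (m + 1)) // u * u = 1 ∧ ¬ PermContainsPattern u ![4, 3, 2, 1] ∧
          ¬ PermContainsPattern u ![3, 1, 2]} +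
        Nat.card {u : Perm (Fin m) // u * u = 1 ∧ ¬ PermContainsPattern u ![4, 3, 2, 1] ∧
          ¬ PermContainsPattern u ![3, 1, 2]} := by
  have hfar : ∀ j : Fin m, Nat.card {u : Perm (Fin (m + 3)) // (u * u = 1 ∧ ¬ PermContainsPattern u ![4, 3, 2, 1] ∧
      ¬ PermContainsPattern u ![3, 1, 2]) ∧ u (Fin.last (m + 2)) = j.castSucc.castSucc.castSucc} = 0 := fun j =>
    card_involutions_av4321_av312_lastFar (m + 2) _ (by simp only [Fin.val_castSucc]; omega)
  rw [card_subtype_eq_sum_fiber₅ (fun u : Perm (Fin (m + 3)) => u * u = 1 ∧ ¬ PermContainsPattern u ![4, 3, 2, 1] ∧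
      ¬ PermContainsPattern u ![3, 1, 2]) (fun u => u (Fin.last (m + 2))), Fin.sum_univ_castSucc, Fin.sum_univ_castSucc,
    Fin.sum_univ_castSucc, Finset.sum_eq_zero (fun j _ => hfar j), zero_add]
  -- the three surviving fibres: `d = 2` (letter `m`), `d = 1` (letter `m + 1`), `d = 0` (the last letter fixed)
  have e2 : Nat.card {u : Perm (Fin (m + 3)) // (u * u = 1 ∧ ¬ PermContainsPattern u ![4, 3, 2, 1] ∧
      ¬ PermContainsPattern u ![3, 1, 2]) ∧ u (Fin.last (m + 2)) = (Fin.last m).castSucc.castSucc} =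
      Nat.card {u : Perm (Fin m) // u * u = 1 ∧ ¬ PermContainsPattern u ![4, 3, 2, 1] ∧
        ¬ PermContainsPattern u ![3, 1, 2]} := by
    rw [← card_involutions_av4321_av312_lastBlock m 2 le_rfl]
    refine Nat.card_congr (Equiv.subtypeEquivRight fun u => and_congr_right fun _ => ?_)
    rw [Fin.ext_iff, Fin.val_castSucc, Fin.val_castSucc, Fin.val_last, show (Fin.last (m + 2) : Fin (m + 3)) =
      Fin.natAdd m (Fin.last 2) from Fin.ext (by simp)]
  have e1 : Nat.card {u : Perm (Fin (m + 3)) // (u * u = 1 ∧ ¬ PermContainsPattern u ![4, 3, 2, 1] ∧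
      ¬ PermContainsPattern u ![3, 1, 2]) ∧ u (Fin.last (m + 2)) = (Fin.last (m + 1)).castSucc} =
      Nat.card {u : Perm (Fin (m + 1)) // u * u = 1 ∧ ¬ PermContainsPattern u ![4, 3, 2, 1] ∧
        ¬ PermContainsPattern u ![3, 1, 2]} := by
    rw [← card_involutions_av4321_av312_lastBlock (m + 1) 1 (by norm_num)]
    refine Nat.card_congr (Equiv.subtypeEquivRight fun u => and_congr_right fun _ => ?_)
    rw [Fin.ext_iff, Fin.val_castSucc, Fin.val_last, show (Fin.last (m + 2) : Fin (m + 3)) =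
      Fin.natAdd (m + 1) (Fin.last 1) from Fin.ext (by simp)]
  have e0 : Nat.card {u : Perm (Fin (m + 3)) // (u * u = 1 ∧ ¬ PermContainsPattern u ![4, 3, 2, 1] ∧
      ¬ PermContainsPattern u ![3, 1, 2]) ∧ u (Fin.last (m + 2)) = Fin.last (m + 2)} =
      Nat.card {u : Perm (Fin (m + 2)) // u * u = 1 ∧ ¬ PermContainsPattern u ![4, 3, 2, 1] ∧
        ¬ PermContainsPattern u ![3, 1, 2]} := by
    rw [← card_involutions_av4321_av312_lastBlock (m + 2) 0 (by norm_num)]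
    refine Nat.card_congr (Equiv.subtypeEquivRight fun u => and_congr_right fun _ => ?_)
    rw [Fin.ext_iff, Fin.val_last, show (Fin.last (m + 2) : Fin (m + 3)) =
      Fin.natAdd (m + 2) (Fin.last 0) from Fin.ext (by simp)]
  rw [e2, e1, e0]
  ring

/-- `|I_0(4321, 312)| = 1`. [cite: BarnabeiBonettiSilimbani2011, Corollary 6 (iii) (arXiv 0812.0463)] -/
theorem card_involutions_av4321_av312_zero :
    Nat.card {u : Perm (Fin 0) // u * u = 1 ∧ ¬ PermContainsPattern u ![4, 3, 2, 1] ∧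
      ¬ PermContainsPattern u ![3, 1, 2]} = 1 := by
  have : Unique {u : Perm (Fin 0) // u * u = 1 ∧ ¬ PermContainsPattern u ![4, 3, 2, 1] ∧
      ¬ PermContainsPattern u ![3, 1, 2]} :=
    { default := ⟨1, by simp, not_contains_of_lt _ _ (by norm_num), not_contains_of_lt _ _ (by norm_num)⟩
      uniq := fun u => Subtype.ext (Equiv.ext fun x => Fin.elim0 x) }
  exact Nat.card_unique

/-- `|I_1(4321, 312)| = 1 = t_3`. [cite: BarnabeiBonettiSilimbani2011, Corollary 6 (iii) (arXiv 0812.0463)] -/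
theorem card_involutions_av4321_av312_one :
    Nat.card {u : Perm (Fin 1) // u * u = 1 ∧ ¬ PermContainsPattern u ![4, 3, 2, 1] ∧
      ¬ PermContainsPattern u ![3, 1, 2]} = 1 := by
  have : Unique {u : Perm (Fin 1) // u * u = 1 ∧ ¬ PermContainsPattern u ![4, 3, 2, 1] ∧
      ¬ PermContainsPattern u ![3, 1, 2]} :=
    { default := ⟨1, by simp, not_contains_of_lt _ _ (by norm_num), not_contains_of_lt _ _ (by norm_num)⟩
      uniq := fun u => Subtype.ext (Subsingleton.elim _ _) }
  exact Nat.card_unique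

/-- `|I_2(4321, 312)| = 2 = t_4` (both permutations of two letters: the last letter fixed, or exchanged with the
first). [cite: BarnabeiBonettiSilimbani2011, Corollary 6 (iii) (arXiv 0812.0463)] -/
theorem card_involutions_av4321_av312_two :
    Nat.card {u : Perm (Fin 2) // u * u = 1 ∧ ¬ PermContainsPattern u ![4, 3, 2, 1] ∧
      ¬ PermContainsPattern u ![3, 1, 2]} = 2 := by
  rw [card_subtype_eq_sum_fiber₅ (fun u : Perm (Fin 2) => u * u = 1 ∧ ¬ PermContainsPattern u ![4, 3, 2, 1] ∧
      ¬ PermContainsPattern u ![3, 1, 2]) (fun u => u (Fin.last 1)), Fin.sum_univ_two]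
  have e0 : Nat.card {u : Perm (Fin 2) // (u * u = 1 ∧ ¬ PermContainsPattern u ![4, 3, 2, 1] ∧
      ¬ PermContainsPattern u ![3, 1, 2]) ∧ u (Fin.last 1) = 0} = 1 :=
    calc _ = Nat.card {u : Perm (Fin (0 + (1 + 1))) // (u * u = 1 ∧ ¬ PermContainsPattern u ![4, 3, 2, 1] ∧
          ¬ PermContainsPattern u ![3, 1, 2]) ∧ ((u (Fin.natAdd 0 (Fin.last 1)) : ℕ)) = 0} :=
            Nat.card_congr (Equiv.subtypeEquivRight fun u => and_congr_right fun _ => by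
              have e : (Fin.natAdd 0 (Fin.last 1) : Fin (0 + (1 + 1))) = (Fin.last 1 : Fin 2) := Fin.ext (by simp)
              rw [e, Fin.ext_iff, Fin.val_zero])
      _ = _ := card_involutions_av4321_av312_lastBlock 0 1 (by norm_num)
      _ = 1 := card_involutions_av4321_av312_zero
  have e1 : Nat.card {u : Perm (Fin 2) // (u * u = 1 ∧ ¬ PermContainsPattern u ![4, 3, 2, 1] ∧
      ¬ PermContainsPattern u ![3, 1, 2]) ∧ u (Fin.last 1) = 1} = 1 :=
    calc _ = Nat.card {u : Perm (Fin (1 + (0 + 1))) // (u * u = 1 ∧ ¬ PermContainsPattern u ![4, 3, 2, 1] ∧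
          ¬ PermContainsPattern u ![3, 1, 2]) ∧ ((u (Fin.natAdd 1 (Fin.last 0)) : ℕ)) = 1} :=
            Nat.card_congr (Equiv.subtypeEquivRight fun u => and_congr_right fun _ => by
              have e : (Fin.natAdd 1 (Fin.last 0) : Fin (1 + (0 + 1))) = (Fin.last 1 : Fin 2) := Fin.ext (by simp)
              rw [e, Fin.ext_iff, show ((1 : Fin 2) : ℕ) = 1 from rfl])
      _ = _ := card_involutions_av4321_av312_lastBlock 1 0 (by norm_num)
      _ = 1 := card_involutions_av4321_av312_one
  rw [e0, e1]

/-- ★★★ **COROLLARY 6 (iii) (Barnabei–Bonetti–Silimbani): `|I_n(4321, 312)| = t_{n+2}`** (Tribonacci; «up to our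
knowledge, new»). [cite: BarnabeiBonettiSilimbani2011, Corollary 6 (iii) (arXiv 0812.0463)] -/
theorem card_involutions_av4321_av312 (n : ℕ) :
    Nat.card {u : Perm (Fin n) // u * u = 1 ∧ ¬ PermContainsPattern u ![4, 3, 2, 1] ∧
      ¬ PermContainsPattern u ![3, 1, 2]} = tribonacci (n + 2) := by
  induction n using Nat.strong_induction_on with
  | _ n ih =>
    rcases n with _ | _ | _ | m
    · rw [card_involutions_av4321_av312_zero]; rfl
    · rw [card_involutions_av4321_av312_one]; rfl
    · rw [card_involutions_av4321_av312_two]; rfl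
    · have h3 : m + 1 + 1 + 1 = m + 3 := rfl
      rw [h3, card_involutions_av4321_av312_add_three m, ih m (by omega), ih (m + 1) (by omega), ih (m + 2) (by omega)]
      conv_rhs => rw [show m + 3 + 2 = (m + 2) + 3 by omega, tribonacci_add_three]

/-- `I_n(4321, 231) = I_n(4321, 312)` as sets of involutions (Simion–Schmidt: an involution avoids `231` iff it avoids
`312`), so `|I_n(4321, 231)| = t_{n+2}` as well. [cite: BarnabeiBonettiSilimbani2011, Corollary 6 (iii) (arXiv 0812.0463)]
[cite: SimionSchmidt1985, Proposition 6 (held text p0009)] -/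
theorem card_involutions_av4321_av231 (n : ℕ) :
    Nat.card {u : Perm (Fin n) // u * u = 1 ∧ ¬ PermContainsPattern u ![4, 3, 2, 1] ∧
      ¬ PermContainsPattern u ![2, 3, 1]} = tribonacci (n + 2) := by
  rw [← card_involutions_av4321_av312 n]
  refine Nat.card_congr (Equiv.subtypeEquivRight fun u => ?_)
  constructor
  · rintro ⟨hinv, h4321, h231⟩
    exact ⟨hinv, h4321, ((involution_and_av231_iff u).1 ⟨hinv, h231⟩).2⟩
  · rintro ⟨hinv, h4321, h312⟩
    exact ⟨hinv, h4321, ((involution_and_av312_iff u).1 ⟨hinv, h312⟩).1⟩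

/-- Values: `|I_n(4321, 312)| = 1, 1, 2, 4, 7, 13, 24` for `n = 0, …, 6` («`|I_3(4321,312)| = 4 = t_5`»).
[cite: BarnabeiBonettiSilimbani2011, Corollary 6 (iii) (arXiv 0812.0463)] -/
theorem card_involutions_av4321_av312_values :
    (List.range 7).map (fun n => Nat.card {u : Perm (Fin n) // u * u = 1 ∧ ¬ PermContainsPattern u ![4, 3, 2, 1] ∧
      ¬ PermContainsPattern u ![3, 1, 2]}) = [1, 1, 2, 4, 7, 13, 24] := by
  simp only [card_involutions_av4321_av312]
  decide

end PermContainsPattern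

end Literature.Combinatorics.Enumerative
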